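import Mathlib
import HarnessLib
import Literature.Analysis.FluidPDE.ClassicalSolution
import Literature.Analysis.FluidPDE.VectorCalculus
import Literature.Analysis.FluidPDE.SwirlTransportProofs
import Literature.Analysis.FluidPDE.LerayProfileCalculus
import Literature.Analysis.FluidPDE.WholeSpaceIBP
import Literature.Analysis.FluidPDE.TypeIAncientMildClassical
import Summits.NavierStokesRegularity.NavierStokesRegularity.Theorems.PoloidalWindowDoorPoloidalWindowRigidityWindow

/-!
# Route `PoloidalWindowDoor` (staged, nsreg-p1), crux `PoloidalWindowRigidity` (K2) — the SCREW COMPONENT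
# `v·h`, `h = e₃ + κ e₃ × x`: its exact transport law along Navier–Stokes, and the poloidal case

Cell ns-regularity-ideate, seat p7 (LEAD on K2; support file for the one open stub, residue (G); census
CENSUS-K2G §11 «the helical stratum»).  For the Killing field of the screw motions about the vertical axis,
`h(y) = e₃ + κ J y` (`J = rotGen`, `J y = (−y₁, y₀, 0)`, pitch parameter `κ ∈ ℝ`), and ANY classical
Navier–Stokes flow `(u, p)` (viscosity `ν`, zero force) on an open time set, the scalar `u·h` obeys, pointwise,

  `(∂ₜ + u·∇ − νΔ)(u·h) = −h·∇p − 2νκ ω₃`,   `ω₃ = (curl u)₃`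

(`screwComponent_transport`): the transport term `⟪u, (u·∇)h⟫ = κ⟪u, Ju⟫` vanishes (`J` is skew), `Δh = 0` (`h` is
affine), and the cross term of the Leibniz rule is `Σᵢ ⟪∂ᵢu, ∂ᵢh⟫ = κ Σᵢ ⟪∂ᵢu, J eᵢ⟫ = κ (∂₀u₁ − ∂₁u₀) = κ ω₃`
(`sum_inner_fderiv_rotGen_eq_curl_two`).  `κ = 0` is the vertical momentum equation; the `κ`-linear part is the
swirl law `(∂ₜ + u·∇ − νΔ)⟪Jx, u⟫ = −⟪Jx, ∇p⟫ − 2ν ω₃` for `Γ = ⟪Jx, u⟫ = x₀u₁ − x₁u₀` WITHOUT axisymmetry (for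
axisymmetric `u`, `⟪Jx,∇p⟫ = 0` and `−2νω₃ = −(2ν/r)∂ᵣΓ`: KNSS 2009 (1.8)).

CONSEQUENCE FOR THE STUB.  On the POLOIDAL class (`ω₃ ≡ 0`) the source reduces to `−h·∇p`
(`screwComponent_transport_of_poloidal`), and for a profile of the route's Type-I class (rate, continuity on the
open slab, unit-viscosity Oseen–Duhamel identity, divergence-free slices; a classical pressure exists on every window
`(t₀,0)`, tree `IsTypeIAncientMild.exists_isClassicalNSSolutionOn_Ioo`) that is poloidal along `e₃`,
`(∂ₜ + v·∇ − Δ)(v·h) = −h·∇p` on every window (`screwComponent_transport_of_class`).  If the profile is moreover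
SCREW-INVARIANT with pitch `κ` (the helical stratum of CENSUS-K2G §11 — the one continuous family of rigid motions the
reshaped stub does not yet exclude), `h·∇p ≡ 0` and `v·h` is exactly the Clebsch stream function `ψ` of
`…Clebsch` (`ω = ∇ψ × e₃`), so `ψ` is transported–diffused: the helical stratum lies in the sub-branch `T ≡ 0`
of the reduced system.  That last step (helical pressure) is NOT taken here.

WHAT THIS IS NOT: not a claim about Navier–Stokes regularity and not the open stub — an exact pointwise identity
(kernel-checked calculus) locating the helical stratum of the residue, for a STAGED door route (bears_on LADDER-NS
N0, rung N0-LocalTubeDoorPoloidal).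
-/

noncomputable section

-- the summit and its single sub-problem share the name (CONVENTIONS §1), as in every Theorems file
set_option linter.dupNamespace false

namespace Summit.NavierStokesRegularity.NavierStokesRegularity.Theorems.PoloidalWindowDoorPoloidalWindowRigidityScrew

open MeasureTheory Set Function Filter Topology Metric InnerProductSpace
open scoped Laplacian RealInnerProductSpace InnerProductSpace
open Literature.Analysis Literature.Analysis.FluidPDE
open Summit.NavierStokesRegularity.NavierStokesRegularity.Theorems.PoloidalWindowDoorPoloidalWindowRigidityWindow

/-- **`Σᵢ ⟪∂ᵢu, J eᵢ⟫ = ω₃`** over the standard basis: `⟪∂₀u, e₁⟫ − ⟪∂₁u, e₀⟫ = ∂₀u₁ − ∂₁u₀ = (curl u)₂`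
(`J e₀ = e₁`, `J e₁ = −e₀`, `J e₂ = 0`). -/
theorem sum_inner_fderiv_rotGen_eq_curl_two (u : EuclideanSpace ℝ (Fin 3) → EuclideanSpace ℝ (Fin 3))
    (x : EuclideanSpace ℝ (Fin 3)) :
    ∑ i : Fin 3, ⟪fderiv ℝ u x (EuclideanSpace.basisFun (Fin 3) ℝ i),
        rotGen (EuclideanSpace.basisFun (Fin 3) ℝ i)⟫_ℝ = curl u x 2 := by
  simp only [EuclideanSpace.basisFun_apply, Fin.sum_univ_three, rotGen_single_zero, rotGen_single_one,
    rotGen_single_two, inner_zero_right, add_zero, inner_neg_right, EuclideanSpace.inner_single_right,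
    one_mul, conj_trivial]
  rw [curl]
  simp
  ring

/-- **The screw Killing field is affine**: `h = e₃ + κ J` has derivative `κ J` everywhere. -/
theorem hasFDerivAt_screwField (κ : ℝ) (y : EuclideanSpace ℝ (Fin 3)) :
    HasFDerivAt (fun y : EuclideanSpace ℝ (Fin 3) => (EuclideanSpace.single 2 (1 : ℝ) : EuclideanSpace ℝ (Fin 3)) + κ • rotGen y)
      (κ • rotGenL) y :=
  ((hasFDerivAt_rotGen y).const_smul κ).const_add _

/-- The screw field is smooth. -/
theorem contDiff_screwField (κ : ℝ) {n : WithTop ℕ∞} :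
    ContDiff ℝ n (fun y : EuclideanSpace ℝ (Fin 3) => (EuclideanSpace.single 2 (1 : ℝ) : EuclideanSpace ℝ (Fin 3)) + κ • rotGen y) :=
  contDiff_const.add (contDiff_rotGen.const_smul κ)

/-- **`Δh = 0`** for the screw field (it is affine). -/
theorem laplacian_screwField (κ : ℝ) (x : EuclideanSpace ℝ (Fin 3)) :
    (Δ fun y : EuclideanSpace ℝ (Fin 3) => (EuclideanSpace.single 2 (1 : ℝ) : EuclideanSpace ℝ (Fin 3)) + κ • rotGen y) x = 0 := by
  rw [laplacian_eq_sum_fderiv_fderiv (EuclideanSpace.basisFun (Fin 3) ℝ) (contDiff_screwField κ) x]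
  refine Finset.sum_eq_zero fun i _ => ?_
  have h : (fun y : EuclideanSpace ℝ (Fin 3) =>
      fderiv ℝ (fun y : EuclideanSpace ℝ (Fin 3) => (EuclideanSpace.single 2 (1 : ℝ) : EuclideanSpace ℝ (Fin 3)) + κ • rotGen y) y
        (EuclideanSpace.basisFun (Fin 3) ℝ i)) =
      fun _ => (κ • rotGenL) (EuclideanSpace.basisFun (Fin 3) ℝ i) := by
    funext y; rw [(hasFDerivAt_screwField κ y).fderiv]
  rw [h, fderiv_fun_const, Pi.zero_apply]
  rfl

/-- **THE SCREW-COMPONENT TRANSPORT LAW.**  For a classical Navier–Stokes flow `(u,p)` (viscosity `ν`, zero force) on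
an open time set `S`, the Killing field `h(y) = e₃ + κ J y` of the screw motions about the vertical axis, `t ∈ S`, `x`:
`∂ₜ(u·h) + (u·∇)(u·h) − νΔ(u·h) = −⟪∇p, h⟫ − 2νκ (curl u)₂`. -/
theorem screwComponent_transport (κ : ℝ) {S : Set ℝ} (hSo : IsOpen S) {ν : ℝ}
    {u : ℝ → EuclideanSpace ℝ (Fin 3) → EuclideanSpace ℝ (Fin 3)} {p : ℝ → EuclideanSpace ℝ (Fin 3) → ℝ}
    (hns : IsClassicalNSSolutionOn S ν 0 u p) {h : EuclideanSpace ℝ (Fin 3) → EuclideanSpace ℝ (Fin 3)}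
    (hh : ∀ y, h y = (EuclideanSpace.single 2 (1 : ℝ) : EuclideanSpace ℝ (Fin 3)) + κ • rotGen y) {t : ℝ} (ht : t ∈ S)
    (x : EuclideanSpace ℝ (Fin 3)) :
    derivWithin (fun τ => ⟪u τ x, h x⟫_ℝ) S t
        + fderiv ℝ (fun y => ⟪u t y, h y⟫_ℝ) x (u t x)
        - ν * (Δ (fun y => ⟪u t y, h y⟫_ℝ)) x =
      -⟪gradient (p t) x, h x⟫_ℝ - 2 * ν * κ * curl (u t) x 2 := by
  have hS : UniqueDiffOn ℝ S := hSo.uniqueDiffOn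
  have hfun : h = fun y => (EuclideanSpace.single 2 (1 : ℝ) : EuclideanSpace ℝ (Fin 3)) + κ • rotGen y := funext hh
  -- ## smoothness of the slice and of the screw field
  have hU2 : ContDiff ℝ 2 (u t) := contDiff_infty.1 (hns.contDiff_velocity ht) 2
  have hH2 : ContDiff ℝ 2 h := hfun ▸ contDiff_screwField κ
  have hUd : ∀ y, DifferentiableAt ℝ (u t) y := fun y => (hU2.differentiable (by norm_num)) y
  have hHd : ∀ y, DifferentiableAt ℝ h y := fun y => (hH2.differentiable (by norm_num)) y
  have hDh : ∀ y w, fderiv ℝ h y w = κ • rotGen w := fun y w => by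
    rw [hfun, (hasFDerivAt_screwField κ y).fderiv]; rfl
  -- ## (T) the time derivative
  have hdu : HasDerivWithinAt (fun τ => u τ x) (timeDerivWithin S u t x) S t := by
    rw [timeDerivWithin_apply]
    exact (hns.smooth_velocity.differentiableWithinAt_time ht x).hasDerivWithinAt
  have hT : derivWithin (fun τ => ⟪u τ x, h x⟫_ℝ) S t = ⟪timeDerivWithin S u t x, h x⟫_ℝ := by
    have h1 := (hdu.inner ℝ (hasDerivWithinAt_const t S (h x))).derivWithin (hS t ht)
    simpa only [inner_zero_right, zero_add] using h1
  -- ## (X) the convective derivative: `⟪u, (u·∇)h⟫ = κ⟪u, Ju⟫ = 0`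
  have hX : fderiv ℝ (fun y => ⟪u t y, h y⟫_ℝ) x (u t x) = ⟪fderiv ℝ (u t) x (u t x), h x⟫_ℝ := by
    rw [fderiv_inner_apply ℝ (hUd x) (hHd x) (u t x), hDh, inner_smul_right, real_inner_comm,
      inner_rotGen_self, mul_zero, zero_add]
  -- ## (L) the Laplacian: `Δ(u·h) = ⟪Δu, h⟫ + 2κ ω₃`
  have hL : (Δ (fun y => ⟪u t y, h y⟫_ℝ)) x = ⟪(Δ (u t)) x, h x⟫_ℝ + 2 * κ * curl (u t) x 2 := by
    rw [laplacian_inner_eq (EuclideanSpace.basisFun (Fin 3) ℝ) hU2 hH2 x, hfun, laplacian_screwField,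
      inner_zero_right, add_zero, ← hfun]
    have hsum : ∑ i, ⟪fderiv ℝ (u t) x (EuclideanSpace.basisFun (Fin 3) ℝ i),
        fderiv ℝ h x (EuclideanSpace.basisFun (Fin 3) ℝ i)⟫_ℝ = κ * curl (u t) x 2 := by
      simp_rw [hDh, inner_smul_right, ← Finset.mul_sum]
      rw [sum_inner_fderiv_rotGen_eq_curl_two]
    rw [hsum]; ring
  -- ## (M) the momentum equation against `h`
  have hM : ⟪timeDerivWithin S u t x, h x⟫_ℝ + ⟪fderiv ℝ (u t) x (u t x), h x⟫_ℝ =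
      ν * ⟪(Δ (u t)) x, h x⟫_ℝ - ⟪gradient (p t) x, h x⟫_ℝ := by
    have h1 := congrArg (fun z => ⟪z, h x⟫_ℝ) (hns.momentum t ht x)
    simpa only [convect_apply, Pi.zero_apply, add_zero, inner_add_left, inner_sub_left, real_inner_smul_left]
      using h1
  rw [hT, hX, hL]
  linear_combination hM

/-- **Poloidal case**: if `(curl u(t))₂ ≡ 0` at `x`, the source is `−h·∇p` alone. -/
theorem screwComponent_transport_of_poloidal (κ : ℝ) {S : Set ℝ} (hSo : IsOpen S) {ν : ℝ}
    {u : ℝ → EuclideanSpace ℝ (Fin 3) → EuclideanSpace ℝ (Fin 3)} {p : ℝ → EuclideanSpace ℝ (Fin 3) → ℝ}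
    (hns : IsClassicalNSSolutionOn S ν 0 u p) {h : EuclideanSpace ℝ (Fin 3) → EuclideanSpace ℝ (Fin 3)}
    (hh : ∀ y, h y = (EuclideanSpace.single 2 (1 : ℝ) : EuclideanSpace ℝ (Fin 3)) + κ • rotGen y) {t : ℝ} (ht : t ∈ S)
    (x : EuclideanSpace ℝ (Fin 3)) (hpol : curl (u t) x 2 = 0) :
    derivWithin (fun τ => ⟪u τ x, h x⟫_ℝ) S t
        + fderiv ℝ (fun y => ⟪u t y, h y⟫_ℝ) x (u t x)
        - ν * (Δ (fun y => ⟪u t y, h y⟫_ℝ)) x =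
      -⟪gradient (p t) x, h x⟫_ℝ := by
  rw [screwComponent_transport κ hSo hns hh ht x, hpol, mul_zero, sub_zero]

/-- **The screw component of a POLOIDAL profile of the route's Type-I class** (rate, continuity on the open slab,
unit-viscosity Oseen–Duhamel identity, divergence-free slices, `⟪curl v(s), e₃⟫ ≡ 0`): for every window `(t₀, 0)`,
`t₀ < 0`, there is a classical pressure `p`, and with it `(∂ₜ + v·∇ − Δ)(v·h) = −h·∇p` pointwise on the window,
for every pitch `κ` (`h = e₃ + κJ`).  The helical stratum of CENSUS-K2G §11 is the case in which, in addition,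
`h·∇p ≡ 0`. -/
theorem screwComponent_transport_of_class {C : ℝ}
    {v : ℝ → EuclideanSpace ℝ (Fin 3) → EuclideanSpace ℝ (Fin 3)}
    (hrate : HasTypeITimeDecay C v) (hcont : ContinuousOn (uncurry v) (Iio (0 : ℝ) ×ˢ univ))
    (hmild : ∀ s t : ℝ, s < t → t < 0 → ∀ x,
      v t x = UnboundedOperators.heatExtension (v s) (t - s) x - oseenDuhamel 1 s v v t x)
    (hdiv : ∀ t < 0, VectorCalculus.IsDivFree (v t))
    (hpol : ∀ s < 0, ∀ y, ⟪curl (v s) y, EuclideanSpace.single 2 (1 : ℝ)⟫_ℝ = 0)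
    (κ : ℝ) {h : EuclideanSpace ℝ (Fin 3) → EuclideanSpace ℝ (Fin 3)}
    (hh : ∀ y, h y = (EuclideanSpace.single 2 (1 : ℝ) : EuclideanSpace ℝ (Fin 3)) + κ • rotGen y) {t₀ : ℝ} (ht₀ : t₀ < 0) :
    ∃ p : ℝ → EuclideanSpace ℝ (Fin 3) → ℝ, IsClassicalNSSolutionOn (Ioo t₀ 0) 1 0 v p ∧
      ∀ s ∈ Ioo t₀ 0, ∀ x,
        derivWithin (fun τ => ⟪v τ x, h x⟫_ℝ) (Ioo t₀ 0) s
            + fderiv ℝ (fun y => ⟪v s y, h y⟫_ℝ) x (v s x)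
            - (Δ (fun y => ⟪v s y, h y⟫_ℝ)) x =
          -⟪gradient (p s) x, h x⟫_ℝ := by
  obtain ⟨p, hns⟩ := (isTypeIAncientMild_of_class hrate hcont hmild hdiv).exists_isClassicalNSSolutionOn_Ioo ht₀
  refine ⟨p, hns, fun s hs x => ?_⟩
  have hω : curl (v s) x 2 = 0 := by
    have h1 := hpol s hs.2 x
    rwa [EuclideanSpace.inner_single_right, one_mul, conj_trivial] at h1
  have h2 := screwComponent_transport_of_poloidal κ isOpen_Ioo hns hh hs x hω
  simpa only [one_mul] using h2

end Summit.NavierStokesRegularity.NavierStokesRegularity.Theorems.PoloidalWindowDoorPoloidalWindowRigidityScrew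

end
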